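import Summits.Ventures.YMGap.RobustBall.LocalSourceScreeningS
import Summits.Ventures.YMGap.RobustBall.LoopActionMember
import HarnessLib

/-!
# Venture YMGap, track ROBUST-BALL (Y2) — TIER 2: Wilson-loop sources on the weighted ball and ON THE LOOP-ACTION NORM BALL
# are screened at the weight rate

HONEST FRAMING. WHAT THIS IS: a venture file (cell `pub-ymgap`, track Y2 ROBUST-BALL, seat rb-p1, theorems only): the
concrete-source reading of `LocalSourceScreeningS.lean` (tier 2, RATE = WEIGHT).  The SOURCE is rb-p1's loop-family action
`loopFamilyAction N γ c = Σ_i c_i Re tr(U_{γ_i})/N` over ANY loop family with finite carrier fibres and finite unweighted norm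
`‖c‖₀ ≤ ε_V` (ANY size: `ε_V` arbitrary), all carriers inside a finite link set `S`; its tier-2 data (link majorant, summable
oscillation witnesses with per-link loads `≤ 2ε_V`) come from `memBallZdS_loopFamilyAction`, and the witnesses are cut down
to the carriers so that they VANISH off `S` (`loopSourceS_witness`).
* `su2_loopSourceS_dim4` — `SU(2)`, `ℤ⁴`: `0 ≤ t`, `6|β_W| e^{a} e^{t} + e^{a/2} √(2/3) Λ < 1` ⇒ for every member `W` of
  `MemBallZdS a Λ t` (INFINITE range), every such loop source, every DLR `μ` of `W`, EVERY DLR `ν` of `W + loopFamilyAction 2 γ c`,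
  every Lipschitz cylinder `F` (`Λ_F`, `K_F`):
  `|∫ F dμ − ∫ F dν| ≤ (√2/2)·min(2ε_V,4)/(1 − ρ) · e^{−t·d(Λ_F,S)} · #Λ_F · K_F`;
* ★ `su2_loopBall_loopSourceS_1_20` — ON THE LOOP-ACTION NORM BALL (the directive's object): at `β_W = 1/20`, every generic
  Wilson-type loop action `W = loopFamilyAction 2 γ₀ c₀` with finite carrier fibres and `‖c₀‖_{log 2} ≤ 1/10` (weight
  `t = log 2`), with ANY further loops of ANY strength inserted inside `S`: every DLR `μ` of `W` and EVERY DLR `ν` of the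
  modified action satisfy `|∫ F dμ − ∫ F dν| ≤ (50√2/17)·min(2ε_V,4) · e^{−(log 2)·d(Λ_F,S)} · #Λ_F · K_F` — halving per lattice
  step (row sum `≤ 83/100`).
WHAT THIS IS NOT: one-sided Dobrushin-comparison rates; nothing about the expectation OF the inserted loops; lattice strong
coupling only, nothing about the continuum limit or a Clay-sense mass gap.
-/

noncomputable section

open MeasureTheory Function Finset ProbabilityTheory Real
open scoped NNReal
open Literature.Probability.LatticeModels
open Literature.Probability.LatticeModels.DobrushinMetric
open Literature.MathematicalPhysics.QuantumLattice
open Literature.MathematicalPhysics.QuantumFieldTheory hiding ZdEdge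

namespace Summit.Ventures.YMGap.RobustBall

variable {d N : ℕ} {ι : Type*}

/-! ### The loop-family source: tier-2 data vanishing off the carriers -/

/-- A loop-family action vanishes on a link set that is the carrier of no loop of the family. -/
theorem loopFamilyAction_eq_zero_of_not_carrier {γ : ι → ZdLoop d} {c : ι → ℝ}
    (hfin : ∀ X, {i | walkEdges (γ i).walk = X}.Finite) {X : Finset (ZdEdge d)} (hX : ∀ i, walkEdges (γ i).walk ≠ X) :
    loopFamilyAction (d := d) N γ c X = 0 := by
  funext U
  have hempty : carrierFib (fun i => walkEdges (γ i).walk) X = ∅ :=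
    Finset.eq_empty_iff_forall_notMem.2 fun i hi => hX i ((mem_carrierFib hfin X i).1 hi)
  simp [loopFamilyAction, indexedPotential_apply, hempty]

/-- **Tier-2 data of a loop-family source, vanishing off the carriers.**  For a loop family with finite carrier fibres and
`‖c‖₀ ≤ ε_V`, all carriers inside `S`: the loop-family action is continuous, depends on its own links, has a link majorant,
and admits summable one-link oscillation witnesses with per-link loads `≤ 2ε_V` that VANISH at every link outside `S`. -/
theorem loopSourceS_witness {γ : ι → ZdLoop d} {c : ι → ℝ} (hfin : ∀ X, {i | walkEdges (γ i).walk = X}.Finite) {εV : ℝ}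
    (hnorm : LoopNormLE 0 γ c εV) {S : Finset (ZdEdge d)} (hS : ∀ i, walkEdges (γ i).walk ⊆ S) :
    (∃ BV, IsLinkSummable (loopFamilyAction (d := d) N γ c) BV) ∧
    (∀ X, Continuous (loopFamilyAction (d := d) N γ c X)) ∧
    (∀ X, DependsOn (loopFamilyAction (d := d) N γ c X) (↑X : Set (ZdEdge d))) ∧
    ∃ oscV : Finset (ZdEdge d) → ZdEdge d → ℝ,
      (∀ X, Dobrushin.IsOscBound (loopFamilyAction (d := d) N γ c X) (oscV X)) ∧
      (∀ e, Summable fun X : Finset (ZdEdge d) => (if e ∈ X then oscV X e else 0)) ∧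
      (∀ e, ∑' X : Finset (ZdEdge d), (if e ∈ X then oscV X e else 0) ≤ 2 * εV) ∧
      (∀ e, e ∉ S → ∑' X : Finset (ZdEdge d), (if e ∈ X then oscV X e else 0) ≤ 0) := by
  classical
  have hmem : MemBallZdS (2 * εV) εV 0 (loopFamilyAction (d := d) N γ c) := memBallZdS_loopFamilyAction hfin hnorm
  obtain ⟨osc, lip, ℓ, hosc, -, hoscs, hosca, -, -, -, -⟩ := hmem.loads
  refine ⟨hmem.summable, hmem.continuous, hmem.dependsOn, ?_⟩
  -- cut the witnesses down to the carriers
  set oscV : Finset (ZdEdge d) → ZdEdge d → ℝ :=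
    fun X e => if ∃ i, walkEdges (γ i).walk = X then osc X e else 0 with hoscV
  have hle : ∀ X e, (if e ∈ X then oscV X e else 0) ≤ (if e ∈ X then osc X e else 0) := fun X e => by
    by_cases he : e ∈ X
    · simp only [if_pos he, hoscV]
      split_ifs
      · exact le_rfl
      · exact (hosc X).nonneg e
    · simp [he]
  have h0 : ∀ X e, 0 ≤ (if e ∈ X then oscV X e else 0) := fun X e => by
    by_cases he : e ∈ X
    · simp only [if_pos he, hoscV]
      split_ifs
      · exact (hosc X).nonneg e
      · exact le_rfl
    · simp [he]
  refine ⟨oscV, fun X => ?_, fun e => Summable.of_nonneg_of_le (h0 · e) (fun X => hle X e) (hoscs e), fun e => ?_,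
    fun e he => ?_⟩
  · by_cases hX : ∃ i, walkEdges (γ i).walk = X
    · refine ⟨fun e => by simp only [hoscV, if_pos hX]; exact (hosc X).nonneg e, fun e σ τ h => ?_⟩
      simp only [hoscV, if_pos hX]
      exact (hosc X).le e σ τ h
    · push Not at hX
      have hzero := loopFamilyAction_eq_zero_of_not_carrier (N := N) (c := c) hfin hX
      refine ⟨fun e => by simp only [hoscV]; split_ifs; exacts [(hosc X).nonneg e, le_rfl], fun e σ τ _ => ?_⟩
      rw [hzero]
      simp only [Pi.zero_apply, sub_self, abs_zero, hoscV]
      split_ifs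
      · exact (hosc X).nonneg e
      · exact le_rfl
  · exact ((Summable.of_nonneg_of_le (h0 · e) (fun X => hle X e) (hoscs e)).tsum_le_tsum (fun X => hle X e)
      (hoscs e)).trans (hosca e)
  · have hzero : (fun X : Finset (ZdEdge d) => if e ∈ X then oscV X e else 0) = fun _ => 0 := by
      funext X
      by_cases heX : e ∈ X
      · have hX : ¬ ∃ i, walkEdges (γ i).walk = X := fun ⟨i, hi⟩ => he (hS i (hi ▸ heX))
        simp [hoscV, heX, hX]
      · simp [heX]
    rw [hzero, tsum_zero]

/-! ### `SU(2)`, `ℤ⁴`: loop sources on the weighted ball -/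

/-- **`SU(2)`, `ℤ⁴` — TIER 2: a loop-family source of ANY strength is screened at the weight rate, uniformly on
`MemBallZdS a Λ t`.**  `0 ≤ t`, `6|β_W| e^{a} e^{t} + e^{a/2} √(2/3) Λ < 1`; member `W ∈ MemBallZdS a Λ t` (bare coupling `β_W/2`);
source: any loop family `γ` with finite carrier fibres and `‖c‖₀ ≤ ε_V`, carriers inside `S`.  Then every DLR `μ` of `W` and
EVERY DLR `ν` of `W + loopFamilyAction 2 γ c` satisfy, for every Lipschitz cylinder `F` (`Λ_F`, `K_F`):
`|∫ F dμ − ∫ F dν| ≤ (√2/2)·min(2ε_V,4)/(1 − ρ) · e^{−t·d(Λ_F,S)} · #Λ_F · K_F`, `ρ = 6|β_W| e^{a} e^{t} + e^{a/2} √(2/3) Λ`. -/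
theorem su2_loopSourceS_dim4 {βW a Λ t : ℝ} (ht : 0 ≤ t)
    (hρ : 6 * |βW| * (exp a * exp t) + exp (a / 2) * Real.sqrt (2 / 3) * Λ < 1)
    {W : Potential (ZdEdge 4) (Matrix.specialUnitaryGroup (Fin 2) ℂ)} (hmem : MemBallZdS a Λ t W)
    {γ : ι → ZdLoop 4} {c : ι → ℝ} (hfin : ∀ X, {i | walkEdges (γ i).walk = X}.Finite) {εV : ℝ}
    (hnorm : LoopNormLE 0 γ c εV) {S : Finset (ZdEdge 4)} (hS : ∀ i, walkEdges (γ i).walk ⊆ S)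
    {μ ν : Measure (LGConfig 4 (Matrix.specialUnitaryGroup (Fin 2) ℂ))}
    (hμ : μ ∈ perturbedGibbsMeasuresS (d := 4) (fundamentalRep (Fin 2)) (2 * (βW / 4)) W)
    (hν : ν ∈ perturbedGibbsMeasuresS (d := 4) (fundamentalRep (Fin 2)) (2 * (βW / 4)) (W + loopFamilyAction 2 γ c))
    {F : LGConfig 4 (Matrix.specialUnitaryGroup (Fin 2) ℂ) → ℝ} {ΛF : Finset (ZdEdge 4)} {KF : ℝ≥0}
    (hF : IsLipschitzCylinder (fundamentalRep (Fin 2)) F ΛF KF) :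
    |(∫ σ, F σ ∂μ) - ∫ σ, F σ ∂ν| ≤
      Real.sqrt 2 / 2 * min (2 * εV) 4 / (1 - (6 * |βW| * (exp a * exp t) + exp (a / 2) * Real.sqrt (2 / 3) * Λ)) *
        exp (-t * setDistEdges ΛF S) * (ΛF.card * KF) := by
  obtain ⟨⟨BV, hVs⟩, hVc, hVdep, oscV, hoscV, hoscVs, hoscVa, hoff⟩ := loopSourceS_witness (N := 2) hfin hnorm hS
  exact su2_localScreeningS_dim4 ht hρ hmem hVs hVc hVdep hoscV hoscVs (bV := fun e =>
    ∑' X : Finset (ZdEdge 4), (if e ∈ X then oscV X e else 0)) (fun e => le_rfl) hoscVa hoff hμ hν hF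

/-! ### On the loop-action norm ball -/

/-- ★ **ON THE LOOP-ACTION NORM BALL: inserted loops are screened, halving per lattice step.**  At `β_W = 1/20` (bare `1/40`),
every generic Wilson-type loop action `W = loopFamilyAction 2 γ₀ c₀` on `ℤ⁴` with finite carrier fibres and weighted norm
`‖c₀‖_{log 2} ≤ 1/10`, and ANY further loop family `γ` of ANY strength (`‖c‖₀ ≤ ε_V`) inserted inside the finite link set `S`:
every DLR state `μ` of `W` and EVERY DLR state `ν` of `W + loopFamilyAction 2 γ c` satisfy, for every Lipschitz cylinder `F`,
`|∫ F dμ − ∫ F dν| ≤ (50√2/17)·min(2ε_V,4) · e^{−(log 2)·d(Λ_F,S)} · #Λ_F · K_F` (row sum `≤ 83/100`). -/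
theorem su2_loopBall_loopSourceS_1_20 {ι₀ : Type*} {γ₀ : ι₀ → ZdLoop 4} {c₀ : ι₀ → ℝ}
    (hfin₀ : ∀ X, {i | walkEdges (γ₀ i).walk = X}.Finite) (hnorm₀ : LoopNormLE (Real.log 2) γ₀ c₀ (1 / 10))
    {γ : ι → ZdLoop 4} {c : ι → ℝ} (hfin : ∀ X, {i | walkEdges (γ i).walk = X}.Finite) {εV : ℝ}
    (hnorm : LoopNormLE 0 γ c εV) {S : Finset (ZdEdge 4)} (hS : ∀ i, walkEdges (γ i).walk ⊆ S)
    {μ ν : Measure (LGConfig 4 (Matrix.specialUnitaryGroup (Fin 2) ℂ))}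
    (hμ : μ ∈ perturbedGibbsMeasuresS (d := 4) (fundamentalRep (Fin 2)) (2 * ((1 / 20 : ℝ) / 4))
      (loopFamilyAction 2 γ₀ c₀))
    (hν : ν ∈ perturbedGibbsMeasuresS (d := 4) (fundamentalRep (Fin 2)) (2 * ((1 / 20 : ℝ) / 4))
      (loopFamilyAction 2 γ₀ c₀ + loopFamilyAction 2 γ c))
    {F : LGConfig 4 (Matrix.specialUnitaryGroup (Fin 2) ℂ) → ℝ} {ΛF : Finset (ZdEdge 4)} {KF : ℝ≥0}
    (hF : IsLipschitzCylinder (fundamentalRep (Fin 2)) F ΛF KF) :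
    |(∫ σ, F σ ∂μ) - ∫ σ, F σ ∂ν| ≤
      50 * Real.sqrt 2 / 17 * min (2 * εV) 4 * exp (-Real.log 2 * setDistEdges ΛF S) * (ΛF.card * KF) := by
  have hmem : MemBallZdS (2 * (1 / 10)) (1 / 10) (Real.log 2) (loopFamilyAction (d := 4) 2 γ₀ c₀) :=
    memBallZdS_loopFamilyAction hfin₀ hnorm₀
  have hq : exp (Real.log 2) = 2 := Real.exp_log (by norm_num)
  -- the row sum at `(β_W; a, Λ; t) = (1/20; 1/5, 1/10; log 2)` is `≤ 83/100`
  have hρle : 6 * |(1 / 20 : ℝ)| * (exp (2 * (1 / 10)) * exp (Real.log 2)) +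
      exp (2 * (1 / 10) / 2) * Real.sqrt (2 / 3) * (1 / 10) ≤ 83 / 100 := by
    rw [hq, abs_of_pos (by norm_num : (0 : ℝ) < 1 / 20)]
    have h1 := exp_le_taylor4 (x := 2 * (1 / 10 : ℝ)) (by norm_num) (by norm_num)
    have h2 := exp_le_taylor4 (x := 2 * (1 / 10 : ℝ) / 2) (by norm_num) (by norm_num)
    calc 6 * (1 / 20 : ℝ) * (exp (2 * (1 / 10)) * 2) + exp (2 * (1 / 10) / 2) * Real.sqrt (2 / 3) * (1 / 10)
        ≤ 6 * (1 / 20 : ℝ) * ((1 + 2 * (1 / 10) + (2 * (1 / 10)) ^ 2 / 2 + (2 * (1 / 10)) ^ 3 / 6 +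
            5 / 96 * (2 * (1 / 10)) ^ 4) * 2) +
          (1 + 2 * (1 / 10) / 2 + (2 * (1 / 10) / 2) ^ 2 / 2 + (2 * (1 / 10) / 2) ^ 3 / 6 +
            5 / 96 * (2 * (1 / 10) / 2) ^ 4) * (8165 / 10000) * (1 / 10) := by
          gcongr
          · exact sqrt_two_thirds_le
      _ ≤ 83 / 100 := by norm_num
  have hρ : 6 * |(1 / 20 : ℝ)| * (exp (2 * (1 / 10)) * exp (Real.log 2)) +
      exp (2 * (1 / 10) / 2) * Real.sqrt (2 / 3) * (1 / 10) < 1 := hρle.trans_lt (by norm_num)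
  have key := su2_loopSourceS_dim4 (Real.log_nonneg (by norm_num)) hρ hmem hfin hnorm hS hμ hν hF
  refine key.trans ?_
  set ρ : ℝ := 6 * |(1 / 20 : ℝ)| * (exp (2 * (1 / 10)) * exp (Real.log 2)) +
      exp (2 * (1 / 10) / 2) * Real.sqrt (2 / 3) * (1 / 10) with hρdef
  have h1ρ : 17 / 100 ≤ 1 - ρ := by linarith
  have hεV : 0 ≤ min (2 * εV) 4 := le_min (by linarith [hnorm.nonneg]) (by norm_num)
  have hinv : 1 / (1 - ρ) ≤ 100 / 17 := by
    rw [div_le_div_iff₀ (by linarith) (by norm_num)]; linarith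
  have hX : 0 ≤ Real.sqrt 2 / 2 * min (2 * εV) 4 * (exp (-Real.log 2 * setDistEdges ΛF S) * (ΛF.card * KF)) := by
    positivity
  calc Real.sqrt 2 / 2 * min (2 * εV) 4 / (1 - ρ) * exp (-Real.log 2 * setDistEdges ΛF S) * (ΛF.card * KF)
      = 1 / (1 - ρ) * (Real.sqrt 2 / 2 * min (2 * εV) 4 * (exp (-Real.log 2 * setDistEdges ΛF S) * (ΛF.card * KF))) := by
        ring
    _ ≤ 100 / 17 * (Real.sqrt 2 / 2 * min (2 * εV) 4 * (exp (-Real.log 2 * setDistEdges ΛF S) * (ΛF.card * KF))) :=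
        mul_le_mul_of_nonneg_right hinv hX
    _ = 50 * Real.sqrt 2 / 17 * min (2 * εV) 4 * exp (-Real.log 2 * setDistEdges ΛF S) * (ΛF.card * KF) := by ring

end Summit.Ventures.YMGap.RobustBall

end
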